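import Summits.CriticalPhenomena.PercolationContinuityZ3.Theorems.PercNearOneGluingNoHeavyLowerTailSunflowerLawPencilForms
import HarnessLib.Audit

/-!
# `NoHeavyLowerTail` (crux stmt-CriticalPhenomena-4575), abstract sunflower cubic at LAW level: the POLARIZED (C1) DICHOTOMY
# `LawPolarizedC1` along one coordinate, and its consequence — both one-step (mixed Bernstein) coefficients of `H` are `≥ 0`

Support file (seat `prim-ineq-gen-2` gen 29; `--supports stmt-CriticalPhenomena-4575`).  Nothing is asserted about the crux; no `sorry`, no named
facts, standard axioms; the `@[conjecture]` definition is an obligation of the programme, never a fact.  Memo: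
run/shared/lean/prim/prim-ineq-gen-2/SHARP-FORM-GEN29.md §6.  Companion of `…SunflowerLawPencilForms` (the polynomials `mixedH`, `mixedLA`,
`mixedLB`, the cell vectors `cells`, and the PROVED Gladkov parts `mixedTop_sections_nonneg`, `mixedBot_sections_nonneg`).

THE PENCIL SPLIT (recalled).  Along the coordinate pencil `t ↦ p[e↦t]` the law cubic `H = (a+b)(ab − e₂(c)) − e₃(c)` of a three-petal
sunflower of up-sets has Bernstein coefficients `H(m₀)`, `⅓·½·mixedH m₁ m₀`, `⅓·½·mixedH m₀ m₁`, `H(m₁)` (`m₀`, `m₁` the cell vectors of the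
two sections), and `½·mixedH u m = mixedLA u m + mixedBot u m = mixedLB u m + mixedTop u m` with `mixedTop, mixedBot ≥ 0` on sections (PROVED,
Gladkov + polarized strong Harris).  Hence the dichotomy below gives `mixedH m₁ m₀ ≥ 0` and `mixedH m₀ m₁ ≥ 0` — gen 28's `LawMixedNonneg` in
the language of `…LawPencilForms` (`mixedH_sections_nonneg_of_lawPolarizedC1`); the identification with gen 28's `triH` and the passage to H-COMB for
all product measures (`LawOneStep.lawH_nonneg_of_mixedNonneg`) is the separate file `…SunflowerLawPencilSplit`.

* `LawPolarizedC1` (typed CONJECTURE, this work): at every finite three-petal sunflower of up-sets, every `p`, every `e`, with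
  `m₀ = cells (p[e↦0])`, `m₁ = cells (p[e↦1])`: `mixedLA m₁ m₀ ≥ 0 ∨ mixedLB m₁ m₀ ≥ 0`, and the mirror with `m₀, m₁` exchanged.
  Census (memo §6–§7): 0 failures on all 146 structures on ≤ 4 points × every `e` × continuous optimisation over `p`; 7 800 random and
  4 × 12 000 annealed `(F, e, p)` on ≤ 7 points; 12 000 annealed instances near the cyclic stars `CS(k₁,k₂,k₃)`, `kᵢ ≤ 4` (where the
  FIBRE-level analogue `FlipPurePayer` fails, `…SunflowerFlipPurePayerRefutation`).
* `mixedH_sections_nonneg_of_dichotomy` (one instance), `mixedH_sections_nonneg_of_lawPolarizedC1` (global) — the reductions.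
-/

noncomputable section

namespace Summit.CriticalPhenomena.PercolationContinuityZ3.Theorems.SunflowerPartition

namespace LawPencil

open MeasureTheory
open Literature.Probability.LatticeModels Literature.Probability.Percolation

variable {ι : Type*} [Fintype ι] [DecidableEq ι]

/-- **POLARIZED (C1-LAW)** (this work; OPEN; "(C1-law) Bernstein-coefficientwise along one coordinate"): for every finite three-petal sunflower
of up-sets `(E₁,E₂,E₃; A)` (`Eᵢ ∩ Eⱼ = A`), every `p` and every coordinate `e`, with `m₀ = cells (p[e↦0])`, `m₁ = cells (p[e↦1])`:
`⟨m₁, ∇LA(m₀)⟩ ≥ 0 ∨ ⟨m₁, ∇LB(m₀)⟩ ≥ 0`, and `⟨m₀, ∇LA(m₁)⟩ ≥ 0 ∨ ⟨m₀, ∇LB(m₁)⟩ ≥ 0` (`mixedLA`, `mixedLB`).  On the diagonal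
(`m₀ = m₁`) this is prim-ineq-prove-1's static dichotomy (C1-law) `max(a,b)·(ab − e₂) ≥ e₃`; numerically clean (memo §6–§7), no proof and
no certificate known (the boundary of the (C1) region is two-sheeted, memo §4).  It implies gen 28's `LawMixedNonneg`, hence H-COMB for all
product measures (`…SunflowerLawPencilSplit`).  An obligation, never a fact: use as `(h : LawPolarizedC1)`. [status: open] -/
@[conjecture] def LawPolarizedC1 : Prop :=
  ∀ (ι : Type) [Fintype ι] [DecidableEq ι] (p : ι → unitInterval) (E₁ E₂ E₃ A : Set (Set ι)),
    IsUpperSet E₁ → IsUpperSet E₂ → IsUpperSet E₃ → E₁ ∩ E₂ = A → E₁ ∩ E₃ = A → E₂ ∩ E₃ = A →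
    ∀ e : ι,
      (0 ≤ mixedLA (cells (Function.update p e 1) E₁ E₂ E₃ A) (cells (Function.update p e 0) E₁ E₂ E₃ A) ∨
          0 ≤ mixedLB (cells (Function.update p e 1) E₁ E₂ E₃ A) (cells (Function.update p e 0) E₁ E₂ E₃ A)) ∧
        (0 ≤ mixedLA (cells (Function.update p e 0) E₁ E₂ E₃ A) (cells (Function.update p e 1) E₁ E₂ E₃ A) ∨
          0 ≤ mixedLB (cells (Function.update p e 0) E₁ E₂ E₃ A) (cells (Function.update p e 1) E₁ E₂ E₃ A))

/-- **REDUCTION at one instance**: the polarized dichotomy at `(p, (E₁,E₂,E₃;A), e)` gives both one-step coefficients `mixedH m₁ m₀ ≥ 0` and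
`mixedH m₀ m₁ ≥ 0` (the Gladkov parts `mixedBot`, `mixedTop` are `≥ 0` on sections, `…LawPencilForms`). [this work] -/
theorem mixedH_sections_nonneg_of_dichotomy (p : ι → unitInterval) {A E₁ E₂ E₃ : Set (Set ι)}
    (h₁ : IsUpperSet E₁) (h₂ : IsUpperSet E₂) (h₃ : IsUpperSet E₃) (h12 : E₁ ∩ E₂ = A) (h13 : E₁ ∩ E₃ = A) (h23 : E₂ ∩ E₃ = A)
    {e : ι}
    (hk1 : 0 ≤ mixedLA (cells (Function.update p e 1) E₁ E₂ E₃ A) (cells (Function.update p e 0) E₁ E₂ E₃ A) ∨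
      0 ≤ mixedLB (cells (Function.update p e 1) E₁ E₂ E₃ A) (cells (Function.update p e 0) E₁ E₂ E₃ A))
    (hk2 : 0 ≤ mixedLA (cells (Function.update p e 0) E₁ E₂ E₃ A) (cells (Function.update p e 1) E₁ E₂ E₃ A) ∨
      0 ≤ mixedLB (cells (Function.update p e 0) E₁ E₂ E₃ A) (cells (Function.update p e 1) E₁ E₂ E₃ A)) :
    0 ≤ mixedH (cells (Function.update p e 1) E₁ E₂ E₃ A) (cells (Function.update p e 0) E₁ E₂ E₃ A) ∧
      0 ≤ mixedH (cells (Function.update p e 0) E₁ E₂ E₃ A) (cells (Function.update p e 1) E₁ E₂ E₃ A) := by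
  have hA := mixedH_cells_nonneg_of_mixedLA_nonneg (Function.update p e 1) (Function.update p e 0)
    (update_zero_le_update_one p e) h₁ h₂ h₃ h12 h13 h23
  have hB := mixedH_cells_nonneg_of_mixedLB_nonneg (Function.update p e 1) (Function.update p e 0)
    (update_zero_le_update_one p e) h₁ h₂ h₃ h12 h13 h23
  refine ⟨?_, ?_⟩
  · rcases hk1 with hLA | hLB
    · exact hA.1 hLA
    · exact hB.1 hLB
  · rcases hk2 with hLA | hLB
    · exact hA.2 hLA
    · exact hB.2 hLB

/-- **REDUCTION (global)**: `LawPolarizedC1` gives both one-step coefficients `≥ 0` at every finite three-petal sunflower of up-sets, every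
`p`, every `e` — gen 28's `LawMixedNonneg` in the language of `…LawPencilForms`. [this work] -/
theorem mixedH_sections_nonneg_of_lawPolarizedC1 (h : LawPolarizedC1) {ι : Type} [Fintype ι] [DecidableEq ι]
    (p : ι → unitInterval) {A E₁ E₂ E₃ : Set (Set ι)}
    (h₁ : IsUpperSet E₁) (h₂ : IsUpperSet E₂) (h₃ : IsUpperSet E₃) (h12 : E₁ ∩ E₂ = A) (h13 : E₁ ∩ E₃ = A) (h23 : E₂ ∩ E₃ = A)
    (e : ι) :
    0 ≤ mixedH (cells (Function.update p e 1) E₁ E₂ E₃ A) (cells (Function.update p e 0) E₁ E₂ E₃ A) ∧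
      0 ≤ mixedH (cells (Function.update p e 0) E₁ E₂ E₃ A) (cells (Function.update p e 1) E₁ E₂ E₃ A) :=
  mixedH_sections_nonneg_of_dichotomy p h₁ h₂ h₃ h12 h13 h23 (h ι p E₁ E₂ E₃ A h₁ h₂ h₃ h12 h13 h23 e).1
    (h ι p E₁ E₂ E₃ A h₁ h₂ h₃ h12 h13 h23 e).2

end LawPencil

end Summit.CriticalPhenomena.PercolationContinuityZ3.Theorems.SunflowerPartition

end
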